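import Summits.Ventures.HSemireg.UntwistAtiyahStepCommute
import Summits.Ventures.HSemireg.CechCupOneAnticommUpTo
import HarnessLib

/-!
# Venture HSemireg — route R1.0, rows `q ≥ 2`: the Atiyah steps commute with scalar `1`-form classes WITHOUT
# common coframes (th-4; (L5) "centrality" of `general-structure/LEIBNIZ-ROW2-PLAN-gs-g4.md` for any framing of `E`
# and any coframes of `Ωʲ`, `Ωʲ⁺¹` on the opens of the cover)

HONEST FRAMING. Module-level homological algebra on the tree's REAL carriers, continuing `UntwistAtiyahStepWedge` /
`UntwistAtiyahStepCommute`: there the class identity `η_j · at_{j+1}(E) = at_j(E) · η_{j+1}` was drawn from the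
EXACT cochain anticommutation available for COMMON coframes of `Ωʲ`, `Ωʲ⁺¹` over one open containing the cover
(the `Ω¹`-free branch). Here the coframes `w_x`, `w'_x` are arbitrary on each open `U_x`: the cochains anticommute
only up to the coframe-transfer operators, and the defect is the coboundary of an explicit `1`-cochain
(`CechCupOneAnticommUpTo`). Nothing about any variety; no twist functor in the statements; nothing here says HC,
HC_CM or HC_AV is proved.

WHAT IS PROVED (`namespace Summit.Ventures.HSemireg.AtiyahStepCommute`).

* `coframeTransfer w w' k θ : Ωʲ|_V → Ωʲ⁺²|_V`, `ω ↦ Σ_{K,L} dc_{KL}(θ) ∧ λ^w_K(ω) ω'_L` (`c_{KL}(θ)` the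
  coordinates of `θ ∧ ω_K|` in `w'`) — **the coframe-transfer operator**: the `e`-free right side of
  `frameConnection_wedge_add` is `φ ≫ coframeTransfer w w' k θ` (`sum_wedgeD_comp_homBasis`); additive in `θ`
  (`coframeTransfer_add`) and compatible with restriction (`restrictHom_coframeTransfer`);
* `atiyahStepCocycle_comp_wedgeForm_add` — for a framing `𝔢` of `E` and coframes `w_x`, `w'_x` of `Ωʲ`, `Ωʲ⁺¹` on
  each `U_x` (`biFramingOfCoframes`): **`a^{(j+1)}_{xy}(φ ≫ (θ ∧ –)) = φ ≫ T_x(θ) - φ ≫ T_y(θ) -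
  a^{(j)}_{xy}(φ) ≫ (θ ∧ –)`**, `T_x = coframeTransfer w_x w'_x`;
* `atiyahClassStep_comp_wedgeClass_of_coframes` — **MAIN**: for a framing `𝔢` of `E` covering `X`, ANY coframes
  `w_x`, `w'_x` of `Ωʲ`, `Ωʲ⁺¹` on the `U_x`, and a scalar Čech `1`-cocycle of `1`-forms `θ` on the cover:
  **`η_j · at_{j+1}(E) = at_j(E) · η_{j+1}` in `Ext²(E ⊗ Ωʲ, E ⊗ Ωʲ⁺²)`**, `η_j = [φ ↦ φ ≫ (θ_{xy} ∧ –)]` — the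
  correction cochain is `G_{xy} = (φ ↦ φ ≫ T_y(θ_{xy}))`, whose coboundary `(dG)_{xyz} = T_y(θ_{xy}) - T_z(θ_{xy})`
  by `θ_{xz} = θ_{xy} + θ_{yz}` and the additivity of `T_z`. So the common-coframe hypothesis of
  `atiyahClassStep_comp_wedgeClass` was a feature of the exact cochain route, not of the class identity: `E`, `Ωʲ`,
  `Ωʲ⁺¹` framed on one cover suffice (e.g. all three finite locally free — refine to a common cover).

Which Ext groups: `Ext¹(E⊗Ωʲ, E⊗Ωʲ⁺¹) ∋ at_j, η_j`, `Ext²(E⊗Ωʲ, E⊗Ωʲ⁺²)`; which class: `at_j` and `[θ]`; which twist: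
none.

## References

* R.-O. Buchweitz, H. Flenner, Compositio Math. 137 (2003), §3 Def. 3.4 / Thm. 3.10, Prop. 3.11 / (2.11.4), Prop. 3.12
  (the `1 ⊗ c` case of the naturality / graded centrality of the Atiyah classes — derived, not printed; proved here).
  [BuchweitzFlenner2003]
* R. Godement, *Topologie algébrique et théorie des faisceaux* (1958), II.6 (cup products up to homotopy).
* K. Kodaira, *Complex Manifolds and Deformation of Complex Structures* (2005), §3.1 (b), §3.2 (c). [Kodaira2005]
-/

set_option backward.isDefEq.respectTransparency false

noncomputable section

universe u

open CategoryTheory CategoryTheory.Abelian AlgebraicGeometry Opposite TopologicalSpace Limits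

namespace Summit.Ventures.HSemireg

namespace AtiyahStepCommute

open Literature.AlgebraicGeometry.Modules Literature.AlgebraicGeometry.Motives
  Literature.AlgebraicGeometry.HodgeTheory Literature.AlgebraicGeometry.Modules.Cech

open scoped Classical

variable {S : Type u} [CommRing S] {X : Over (Spec (CommRingCat.of S))} (E : X.left.Modules) (j : ℕ)
  {W V V' : X.left.Opens} {K K' : Type u}

/-! ### The coframe-transfer operator -/

section Transfer

variable {E j} [Fintype K] [Fintype K'] (w : SheafOfModules.free K ≅ (hodgeSheaf X j).over W)
  (w' : SheafOfModules.free K' ≅ (hodgeSheaf X (j + 1)).over W)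

variable (j) in
/-- **The coframe-transfer operator** `T_{w,w'}(θ) : Ωʲ|_V → Ωʲ⁺²|_V`, `ω ↦ Σ_{K,L} dc_{KL}(θ) ∧ λ^w_K(ω) ω'_L` with
`c_{KL}(θ)` the coordinates of `θ ∧ ω_K|_V` in the coframe `w'` (`V ≤ W`). [folklore] -/
def coframeTransfer (k : V ⟶ W) (θ : Γ(cotangentSheaf X, V)) :
    (hodgeSheaf X j).over V ⟶ (hodgeSheaf X (j + 1 + 1)).over V :=
  ∑ KL : K × K', restrictHom k (homBasis w w' KL) ≫ wedgeForm (j + 1)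
    (dSection X V (coord w' k (wedgeAt j θ ((hodgeSheaf X j).presheaf.map k.op (basisSection w KL.1))) KL.2))

/-- The `e`-free right side of `frameConnection_wedge_add` is `φ ≫ T_{w,w'}(θ)`. [folklore] -/
theorem sum_wedgeD_comp_homBasis (k : V ⟶ W) (φ : (dual E).over V ⟶ (hodgeSheaf X j).over V)
    (θ : Γ(cotangentSheaf X, V)) :
    ∑ KL : K × K', wedgeD E (j + 1) V
        (coord w' k (wedgeAt j θ ((hodgeSheaf X j).presheaf.map k.op (basisSection w KL.1))) KL.2)
        (φ ≫ restrictHom k (homBasis w w' KL)) = φ ≫ coframeTransfer j w w' k θ := by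
  rw [coframeTransfer, Preadditive.comp_sum]
  refine Finset.sum_congr rfl fun KL _ => ?_
  rw [wedgeD_eq_comp_wedgeForm, Category.assoc]

/-- `T_{w,w'}` is additive in `θ`. [folklore] -/
theorem coframeTransfer_add (k : V ⟶ W) (θ θ' : Γ(cotangentSheaf X, V)) :
    coframeTransfer j w w' k (θ + θ') = coframeTransfer j w w' k θ + coframeTransfer j w w' k θ' := by
  rw [coframeTransfer, coframeTransfer, coframeTransfer, ← Finset.sum_add_distrib]
  refine Finset.sum_congr rfl fun KL _ => ?_
  rw [wedgeAt_add_left, coord_add, dSection_add, wedgeForm_add, Preadditive.comp_add]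

/-- `T_{w,w'}` is compatible with restriction. [folklore] -/
theorem restrictHom_coframeTransfer (k : V ⟶ W) (l : V' ⟶ V) (θ : Γ(cotangentSheaf X, V)) :
    restrictHom l (coframeTransfer j w w' k θ) =
      coframeTransfer j w w' (l ≫ k) ((cotangentSheaf X).presheaf.map l.op θ) := by
  rw [coframeTransfer, coframeTransfer, restrictHom_finset_sum]
  refine Finset.sum_congr rfl fun KL _ => ?_
  rw [restrictHom_comp, ← restrictHom_comp', restrictHom_wedgeForm, map_dSection, ← coord_map, map_wedgeAt,
    presheaf_map_map]

/-- `T` does not depend on the names of the vertex and of the inclusion. [folklore] -/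
theorem comp_coframeTransfer_congr {ι : Type u} {U : ι → X.left.Opens} {Kf K'f : ι → Type u}
    [∀ a, Fintype (Kf a)] [∀ a, Fintype (K'f a)]
    (wf : ∀ a, SheafOfModules.free (Kf a) ≅ (hodgeSheaf X j).over (U a))
    (wf' : ∀ a, SheafOfModules.free (K'f a) ≅ (hodgeSheaf X (j + 1)).over (U a))
    {v v' : ι} (hv : v = v') (kk : V ⟶ U v) (kk' : V ⟶ U v')
    (φ : (dual E).over V ⟶ (hodgeSheaf X j).over V) (θ : Γ(cotangentSheaf X, V)) :
    φ ≫ coframeTransfer j (wf v) (wf' v) kk θ = φ ≫ coframeTransfer j (wf v') (wf' v') kk' θ := by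
  subst hv
  rw [Subsingleton.elim kk kk']

end Transfer

/-! ### Bi-framings with arbitrary coframes: the cocycles anticommute up to transfer terms -/

section Coframes

variable {E j} {ι : Type u} (𝔢 : Framing E ι) {Kf K'f : ι → Type u} [∀ a, Fintype (Kf a)] [∀ a, Fintype (K'f a)]

variable (j) in
/-- The bi-framing of `E` and `Ωʲ` on the cover of a framing `𝔢` of `E` with given coframes `w_x` of `Ωʲ|_{U_x}`.
[cite: Kodaira2005, §3.2 (c)] -/
def biFramingOfCoframes (w : ∀ a, SheafOfModules.free (Kf a) ≅ (hodgeSheaf X j).over (𝔢.U a)) :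
    BiFraming E (hodgeSheaf X j) ι where
  U := 𝔢.U
  I := 𝔢.I
  K := Kf
  e := 𝔢.e
  w := w

variable (w : ∀ a, SheafOfModules.free (Kf a) ≅ (hodgeSheaf X j).over (𝔢.U a))
  (w' : ∀ a, SheafOfModules.free (K'f a) ≅ (hodgeSheaf X (j + 1)).over (𝔢.U a))

/-- **The level-`j` and level-`(j+1)` Atiyah cocycles of bi-framings with the same frames of `E` and ARBITRARY
coframes anticommute with `θ ∧ –` up to the transfer terms**:
`a^{(j+1)}_{xy}(φ ≫ (θ ∧ –)) + a^{(j)}_{xy}(φ) ≫ (θ ∧ –) = φ ≫ T_x(θ) - φ ≫ T_y(θ)`.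
[cite: BuchweitzFlenner2003, Def. 3.4] [cite: Kodaira2005, §3.1 (b)] -/
theorem atiyahStepCocycle_comp_wedgeForm_add (β : Fin 2 → ι) (k : V ⟶ face 𝔢.U β)
    (φ : Γ(twistHodge E j, V)) (θ : Γ(cotangentSheaf X, V)) :
    appLE (atiyahStepCocycle E (j + 1) (biFramingOfCoframes (j + 1) 𝔢 w') β) k
        (((φ : (dual E).over V ⟶ (hodgeSheaf X j).over V) ≫ wedgeForm j θ :
          (dual E).over V ⟶ (hodgeSheaf X (j + 1)).over V) : Γ(twistHodge E (j + 1), V)) =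
      (φ : (dual E).over V ⟶ (hodgeSheaf X j).over V) ≫
          coframeTransfer j (w (β 0)) (w' (β 0)) (k ≫ homOfLE (face_le 𝔢.U β 0)) θ -
        (φ : (dual E).over V ⟶ (hodgeSheaf X j).over V) ≫
          coframeTransfer j (w (β 1)) (w' (β 1)) (k ≫ homOfLE (face_le 𝔢.U β 1)) θ -
        ((appLE (atiyahStepCocycle E j (biFramingOfCoframes j 𝔢 w) β) k φ : Γ(twistHodge E (j + 1), V)) :
          (dual E).over V ⟶ (hodgeSheaf X (j + 1)).over V) ≫ wedgeForm (j + 1) θ := by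
  rw [appLE_atiyahStepCocycle, appLE_atiyahStepCocycle]
  dsimp only [biFramingOfCoframes]
  rw [← sum_wedgeD_comp_homBasis, ← sum_wedgeD_comp_homBasis,
    ← frameConnection_wedge_add (𝔢.e (β 0)) (w (β 0)) (w' (β 0)) (k ≫ homOfLE (face_le 𝔢.U β 0)) φ θ,
    ← frameConnection_wedge_add (𝔢.e (β 1)) (w (β 1)) (w' (β 1)) (k ≫ homOfLE (face_le 𝔢.U β 1)) φ θ,
    Preadditive.sub_comp]
  abel

end Coframes

/-! ### The class identity for arbitrary coframes -/

section Classes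

variable {E j} {ι : Type u} {U : ι → X.left.Opens}

/-- Values of gs-g4's local post-composition on sections. [folklore] -/
lemma appLE_postcompOver_section {M N : X.left.Modules} {U' : X.left.Opens} (f : M.over U' ⟶ N.over U')
    (k : V ⟶ U') (φ : Γ(sheafHom (dual E) M, V)) :
    appLE (CocycleTwist.postcompOver (dual E) f) k φ =
      (((φ : (dual E).over V ⟶ M.over V) ≫ restrictHom k f : (dual E).over V ⟶ N.over V) :
        Γ(sheafHom (dual E) N, V)) := rfl

/-- A family of sections on the faces does not depend on the name of the face. [folklore] -/
lemma map_family_congr {M : X.left.Modules} (θ : ∀ β : Fin 2 → ι, Γ(M, face U β)) {β β' : Fin 2 → ι}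
    (h : β = β') (kk : V ⟶ face U β) (kk' : V ⟶ face U β') :
    M.presheaf.map kk.op (θ β) = M.presheaf.map kk'.op (θ β') := by
  subst h
  rw [Subsingleton.elim kk kk']

variable [HasExt.{u + 1} X.left.Modules]

/-- **The Atiyah steps commute with scalar `1`-form classes, for arbitrary coframes.** For a framing `𝔢` of `E`
covering `X`, coframes `w_x`, `w'_x` of `Ωʲ`, `Ωʲ⁺¹` on each `U_x`, and a scalar Čech `1`-cocycle of `1`-forms
`θ = (θ_{xy})` on the cover: `η_j · at_{j+1}(E) = at_j(E) · η_{j+1}` in `Ext²(E ⊗ Ωʲ, E ⊗ Ωʲ⁺²)` (Mathlib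
`Ext.comp` order), `η_j = [φ ↦ φ ≫ (θ_{xy} ∧ –)]`; the `1 ⊗ c` case (`c = [θ]`) of the naturality / graded
centrality of the Atiyah classes (Buchweitz–Flenner Prop. 3.11 / (2.11.4), Prop. 3.12) — derived, not printed
there; proved here by `Cech.comp_classOf_eq_of_anticomm_add` with the correction cochain
`G_{xy} = (φ ↦ φ ≫ T_y(θ_{xy}))`. [cite: BuchweitzFlenner2003, Prop. 3.12] -/
theorem atiyahClassStep_comp_wedgeClass_of_coframes (𝔢 : Framing E ι) (hcov : iSup 𝔢.U = ⊤)
    {Kf K'f : ι → Type u} [∀ a, Fintype (Kf a)] [∀ a, Fintype (K'f a)]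
    (w : ∀ a, SheafOfModules.free (Kf a) ≅ (hodgeSheaf X j).over (𝔢.U a))
    (w' : ∀ a, SheafOfModules.free (K'f a) ≅ (hodgeSheaf X (j + 1)).over (𝔢.U a))
    (θ : ∀ β : Fin 2 → ι, Γ(cotangentSheaf X, face 𝔢.U β))
    (hθ : ∀ τ : Fin 3 → ι,
      (cotangentSheaf X).presheaf.map (homOfLE (face_le_face_comp 𝔢.U τ (Fin.succAbove 1))).op
          (θ (τ ∘ Fin.succAbove 1)) =
        (cotangentSheaf X).presheaf.map (homOfLE (face_le_face_comp 𝔢.U τ (Fin.succAbove 0))).op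
            (θ (τ ∘ Fin.succAbove 0)) +
          (cotangentSheaf X).presheaf.map (homOfLE (face_le_face_comp 𝔢.U τ (Fin.succAbove 2))).op
            (θ (τ ∘ Fin.succAbove 2))) :
    (Cech.classOf (Cech.exactAugmentation 𝔢.U (twistHodge E (j + 1)) hcov)
        (fun β => CocycleTwist.postcompOver (dual E) (wedgeForm j (θ β)) :
          LocalFamily 𝔢.U 1 (twistHodge E j) (twistHodge E (j + 1)))
        (dFamily_postcompOver_wedgeForm θ hθ)).comp (atiyahClassStep E (j + 1)) rfl =
      (atiyahClassStep E j).comp (Cech.classOf (Cech.exactAugmentation 𝔢.U (twistHodge E (j + 1 + 1)) hcov)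
        (fun β => CocycleTwist.postcompOver (dual E) (wedgeForm (j + 1) (θ β)) :
          LocalFamily 𝔢.U 1 (twistHodge E (j + 1)) (twistHodge E (j + 1 + 1)))
        (dFamily_postcompOver_wedgeForm θ hθ)) rfl := by
  rw [atiyahClassStep_eq_classOf_exactAugmentation E (j + 1) (biFramingOfCoframes (j + 1) 𝔢 w') hcov,
    atiyahClassStep_eq_classOf_exactAugmentation E j (biFramingOfCoframes j 𝔢 w) hcov]
  refine Cech.comp_classOf_eq_of_anticomm_add (U := 𝔢.U) (atiyahStepCocycle E j (biFramingOfCoframes j 𝔢 w))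
    (fun β => CocycleTwist.postcompOver (dual E) (wedgeForm (j + 1) (θ β)))
    (fun β => CocycleTwist.postcompOver (dual E) (wedgeForm j (θ β)))
    (atiyahStepCocycle E (j + 1) (biFramingOfCoframes (j + 1) 𝔢 w'))
    (fun β => CocycleTwist.postcompOver (dual E)
      (coframeTransfer j (w (β 1)) (w' (β 1)) (homOfLE (face_le 𝔢.U β 1)) (θ β)))
    _ _ _ (Cech.exactAugmentation_ε _ _ hcov) (Cech.exactAugmentation_ε _ _ hcov) _ _ _ _ fun τ W' k x => ?_
  -- the inclusions of `W'` into the three edges and the three vertices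
  have h12 : face 𝔢.U τ ≤ 𝔢.U (τ 1) := face_le 𝔢.U τ 1
  have h22 : face 𝔢.U τ ≤ 𝔢.U (τ 2) := face_le 𝔢.U τ 2
  -- (1) the wedge values and the cochain identity on the edge `(τ 1, τ 2) = back 1 τ`
  rw [appLE_postcompOver_wedgeForm, appLE_postcompOver_wedgeForm]
  have hC := atiyahStepCocycle_comp_wedgeForm_add 𝔢 w w' (back 1 τ) (k ≫ homOfLE (face_le_face_back 𝔢.U 1 τ)) x
    ((cotangentSheaf X).presheaf.map (k ≫ homOfLE (face_le_face_front 𝔢.U τ)).op (θ (front τ)))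
  rw [comp_coframeTransfer_congr (j := j) w w' (show back 1 τ 0 = τ 1 from congrArg τ (by decide)) _
      (k ≫ homOfLE h12),
    comp_coframeTransfer_congr (j := j) w w' (show back 1 τ 1 = τ 2 from congrArg τ (by decide)) _
      (k ≫ homOfLE h22),
    map_family_congr θ (Cech.front_eq_comp_succAbove_two τ) _
      (k ≫ homOfLE (face_le_face_comp 𝔢.U τ (Fin.succAbove 2)))] at hC
  rw [map_family_congr θ (Cech.front_eq_comp_succAbove_two τ) _
      (k ≫ homOfLE (face_le_face_comp 𝔢.U τ (Fin.succAbove 2))), hC]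
  -- (2) the coboundary of the correction cochain
  rw [dFamily, appLE_sum, Fin.sum_univ_three, appLE_zsmul, appLE_zsmul, appLE_zsmul, appLE_restrictHom,
    appLE_restrictHom, appLE_restrictHom]
  simp only [Fin.val_zero, pow_zero, one_smul, Fin.val_one, pow_one, neg_one_zsmul, Fin.val_two, neg_one_sq]
  rw [appLE_postcompOver_section, appLE_postcompOver_section, appLE_postcompOver_section,
    restrictHom_coframeTransfer, restrictHom_coframeTransfer, restrictHom_coframeTransfer,
    comp_coframeTransfer_congr (j := j) w w'
      (show (τ ∘ Fin.succAbove 0) 1 = τ 2 from congrArg τ (by decide)) _ (k ≫ homOfLE h22),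
    comp_coframeTransfer_congr (j := j) w w'
      (show (τ ∘ Fin.succAbove 1) 1 = τ 2 from congrArg τ (by decide)) _ (k ≫ homOfLE h22),
    comp_coframeTransfer_congr (j := j) w w'
      (show (τ ∘ Fin.succAbove 2) 1 = τ 1 from congrArg τ (by decide)) _ (k ≫ homOfLE h12)]
  -- (3) the scalar cocycle relation `θ_{xz}| = θ_{yz}| + θ_{xy}|` over `W'`
  have hθW := congrArg ((cotangentSheaf X).presheaf.map k.op) (hθ τ)
  rw [map_add, presheaf_map_map, presheaf_map_map, presheaf_map_map] at hθW
  rw [hθW, coframeTransfer_add, Preadditive.comp_add]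
  -- everything is now a local homomorphism over `W'`: finish in the additive group of homomorphisms
  change @Eq ((dual E).over W' ⟶ (hodgeSheaf X (j + 1 + 1)).over W') _ _
  abel

end Classes

end AtiyahStepCommute

end Summit.Ventures.HSemireg

end
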